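import Summits.Langlands.Langlands.Theses.GoldenFieldSerre
import Literature.NumberTheory.GaloisRepresentations.ArtinRestriction

/-!
# Birth skeleton (BC3) for crux stmt-Langlands-17049
`Summit.Langlands.Langlands.Theses.GoldenFieldSerre.KillingRamificationGolden` — line `birth`

THE CRUX (route `route-Langlands-GoldenFieldSerre`, rank 4): LEVEL-ONE Serre over the golden
field `F ≅ ℚ(√5)` (every irreducible, totally odd `ρ̄ : Γ_F → GL₂(k)`, `char k = p`, unramified
away from `p`, is modular — for every `p`) implies `SerreGolden` (the same with no ramification
hypothesis).  The line is Khare–Wintenberger's architecture of *Serre's modularity conjecture (I)*,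
Invent. Math. 178 (2009) 485–504, §3 and §8, transplanted to `F`:

* `stub_raiseToDihedral`    — KW Thm. 3.4 (raising levels, with Thm. 5.1(4), Lemma 8.2, Lemma 6.3)
  over `F`: Serre for LOCALLY GOOD-DIHEDRAL `ρ̄` implies Serre for every `ρ̄` with NON-SOLVABLE image;
* `stub_solvableImage`      — KW Lemma 6.2(i) over `F`: the solvable-image case (Langlands–Tunnell,
  Hecke–Jacquet–Langlands induction, weight-one-to-cohomological-weight congruences);
* `stub_dihedralLadder`     — KW Thm. 3.1 (killing ramification in weight two) + Thm. 3.2 (weight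
  reduction) over `F`: good-dihedral Serre at ramification depth `≤ r` gives depth `≤ r + 1` (`r ≥ 1`);
* `stub_dihedralBase`       — KW Thm. 3.3 = Khare (2006) Cor. 1.2 over `F`: level-one Serre over `F`
  gives good-dihedral Serre at depth `1` (only the dihedral place ramified away from `p`).

Composition `KillingRamificationGolden_of` (kernel-checked, no `sorry`): depth `0` is vacuous (a
good-dihedral datum forces ramification at `q ∤ p`), depth `1` is the base, the ladder gives every
depth by induction, finiteness of ramification (landed
`FramedGaloisRep.eventually_isUnramifiedAt_of_isOpen_ker`, open kernel because `k` is discrete)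
turns "every depth" into "every good-dihedral `ρ̄`", and raising + the solvable case give
`SerreGolden`; the conclusion is the route decl BY NAME.

LINE VOCABULARY (this file, §0): `IsSerreModular p ρ̄` (the `∃ π` clause of `SerreGolden`,
verbatim), `LevelOneGolden` (the crux hypothesis, verbatim), `resChar v` (residue characteristic),
`IsGoodDihedralDatum p ρ̄ q t b` (KW Def. 2.1 transplanted: split auxiliary place `q ∤ p` of prime
norm, inertia at `q` acting through a non-trivial `t`-group with `t ∤ Nq - 1`, `t ∣ Nq + 1`,
`t` prime `> 5`, `t > b ≥ p` and `b ≥` the residue characteristic of every other ramified place, the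
conjugate place of `q` unramified, and — replacing KW's `q ≡ 1 mod 8r` — `q` SPLIT in every quadratic
`K/F` unramified at all places of residue characteristic `> b`; this is the form of KW (ii) that is
stable along compatible-system chains over `F`, where units of `F` obstruct a purely congruential
condition), `GDSerre r` / `GDSerreAll` (good-dihedral Serre at depth `≤ r` / at every depth).

Disproof used: none — `Cruxes/KillingRamificationGolden/` had no `Disproof.lean` and no landed
`Negative/` lemma at registration (2026-08-17); `ledger negatives --problem Langlands` unrelated.

BC3 (planner-skel, 2026-08-17): `lean check --json` rc 0, sorries 4 = the four `stub_*`, zero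
elsewhere; `#h21_check_skeleton` ok (theorem `KillingRamificationGolden_of`, no extra hypothesis);
probes `stub → KillingRamificationGolden` and `stub → Langlands` by `first | exact? | simpa | aesop`
FAIL for all four stubs (aesop exhaustive search fails, `exact?`/`simpa` fail; also `exact?` after
unfolding the crux / `Langlands`): files `bc/stub_<name>_probe.lean` in the registrar's folder,
verdicts in `Lines/birth.md`.
-/

set_option linter.dupNamespace false

noncomputable section

namespace Summit.Langlands.Langlands.Cruxes.KillingRamificationGolden.Birth

open Summit.Langlands.Langlands.Theses.GoldenFieldSerre
open scoped NumberField
open NumberField IsDedekindDomain Field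
open Literature.NumberTheory.GaloisRepresentations Literature.NumberTheory.Automorphic

/-! ## 0. Line vocabulary -/

/-- **`ρ̄` is (Serre-)modular**: the conclusion clause of `SerreGolden` / `KillingRamificationGolden`,
VERBATIM — there are a compact-open level witness `hcpt`, a cuspidal automorphic representation `π`
of `GL₂(𝔸_F)` which is regular algebraic, `ι : ℚ̄_p ≃ ℂ` and a reduction map `red : ℤ̄_p → k` such
that at all but finitely many places `w` the Hecke (Satake) polynomial of `π` at `w` is `p`-integral
and reduces to the characteristic polynomial of `ρ̄(Frob_w)`.
[cite: BuzzardDiamondJarvis2010, Conj. 1.1] [folklore] -/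
def IsSerreModular {F : Type} [Field F] [NumberField F] (p : ℕ) [Fact p.Prime] {k : Type} [Field k]
    [TopologicalSpace k] (ρ : FramedGaloisRep F k 2) : Prop :=
  ∃ (hcpt : isCompact_glFiniteIntegralLevel 2 F) (π : CuspidalAutomorphicRepData 2 F hcpt)
    (ι : PadicAlgCl p ≃+* ℂ) (red : (Valued.v : Valuation (PadicAlgCl p) NNReal).valuationSubring →+* k),
    π.1.IsRegularAlgebraic ∧ ∀ᶠ w in Filter.cofinite, ∃ α : Multiset ℂ, π.1.HasSatakeParamAt w α ∧
      ∃ P₀ : Polynomial (Valued.v : Valuation (PadicAlgCl p) NNReal).valuationSubring,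
        P₀.map (Valued.v : Valuation (PadicAlgCl p) NNReal).valuationSubring.subtype =
            arithFrobPolyOfSatake ι w.residueCard 2 α ∧
          ρ.IsUnramifiedAt w ∧ ρ.HasFrobCharpolyAt w (P₀.map red)

/-- **Level-one Serre over the golden field** — the HYPOTHESIS of the crux, verbatim (it is the
conclusion of the route's `WeightCyclesGolden`): for `F` of degree `2` containing `√5`, every prime
`p`, every algebraically closed discrete `k` of characteristic `p` and every continuous irreducible
totally odd `ρ̄ : Γ_F → GL₂(k)` unramified at all places not dividing `p`, `ρ̄` is modular.
[cite: KhareWintenberger2009, Thm. 1.2 (level one over ℚ: Khare 2006)] [folklore] -/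
def LevelOneGolden : Prop :=
  ∀ (F : Type) [Field F] [NumberField F], Module.finrank ℚ F = 2 → (∃ a : F, a ^ 2 = 5) →
    ∀ (p : ℕ) [Fact p.Prime], ∀ (k : Type) [Field k] [CharP k p] [IsAlgClosed k] [TopologicalSpace k]
      [DiscreteTopology k], ∀ ρ : FramedGaloisRep F k 2, FramedRep.IsIrreducible ρ → ρ.IsOdd →
        (∀ v : HeightOneSpectrum (𝓞 F), ((p : ℕ) : 𝓞 F) ∉ v.asIdeal → ρ.IsUnramifiedAt v) →
          IsSerreModular p ρ

/-- The **residue characteristic** of a finite place `v` of a number field: the prime below `v`,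
read off as the least prime factor of `N v = #(𝓞 F ⧸ v) = ℓ^f`. [folklore] -/
def resChar {F : Type} [Field F] [NumberField F] (v : HeightOneSpectrum (𝓞 F)) : ℕ :=
  v.residueCard.minFac

/-- **Good-dihedral datum** (Khare–Wintenberger Def. 2.1, transplanted to a real quadratic base
field).  `IsGoodDihedralDatum p ρ̄ q t b` says that the finite place `q` of `F`, the prime `t` and
the bound `b` make `ρ̄ : Γ_F → GL₂(k)` (residue characteristic `p`) *locally good-dihedral at `q`*:
(D1) `q ∤ p`, `N q` is prime (SPLIT-PRIME DISCIPLINE: `F_q = ℚ_{Nq}`), `ρ̄` is ramified at `q` and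
unramified at every other place of the same residue characteristic;
(D2) `t` is a prime with `t > 5`, `t > b`, `t ∤ N q - 1`, `t ∣ N q + 1` (niveau two);
(D3) `b ≥ p`, `b ≥` the residue characteristic of every ramified place `≠ q`, and `b <` the
residue characteristic of `q` (KW: `t > max(Q(N(ρ̄)/q²), 5, p)`, and `q > ` that max by (ii));
(D4) every inertia group at `q` acts through a finite `t`-group (so `ρ̄|_{I_q} ≃ ψ ⊕ ψ^{Nq}` with
`ψ` of order `t^a`, `a ≥ 1` by (D1));
(D5) `q` splits completely in every quadratic extension `K/F` unramified at all places of residue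
characteristic `> b` — the base-field form of KW's "`q ≡ 1 mod 8` and `≡ 1 mod r` for all primes
`r ≤ max(Q(N/q²), p)`", which is what excludes dihedral images along the chains (a quadratic `K/F`
from which a `q`-dihedral `ρ̄'` of the chain would be induced is unramified outside residue
characteristics `≤ b` and INERT at `q`).  Over `F` a congruence on `N q` alone cannot control the
unit `(1+√5)/2`, hence the splitting formulation.  The conditions are stable under passing to the
residual representations of the compatible systems used in KW §8 (new residue characteristics are
`≤ b`, ramification does not grow, inertia at `q` keeps its `t`-power order since `t > b`).
[cite: KhareWintenberger2009, Def. 2.1 and Lemma 6.3] [folklore] -/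
def IsGoodDihedralDatum {F : Type} [Field F] [NumberField F] (p : ℕ) {k : Type} [Field k]
    [TopologicalSpace k] (ρ : FramedGaloisRep F k 2) (q : HeightOneSpectrum (𝓞 F)) (t b : ℕ) :
    Prop :=
  -- (D1) the auxiliary place: away from `p`, split, ramified, clean conjugate
  (((p : ℕ) : 𝓞 F) ∉ q.asIdeal ∧ q.residueCard.Prime ∧ ¬ ρ.IsUnramifiedAt q ∧
    ∀ v : HeightOneSpectrum (𝓞 F), v ≠ q → resChar v = resChar q → ρ.IsUnramifiedAt v) ∧
  -- (D2) the dihedral prime `t`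
  (t.Prime ∧ 5 < t ∧ b < t ∧ ¬ (t ∣ q.residueCard - 1) ∧ t ∣ q.residueCard + 1) ∧
  -- (D3) the bound `b`: above `p` and every other ramified residue characteristic, below `q`'s
  (p ≤ b ∧ b < resChar q ∧
    ∀ v : HeightOneSpectrum (𝓞 F), v ≠ q → ¬ ρ.IsUnramifiedAt v → resChar v ≤ b) ∧
  -- (D4) inertia at `q` acts through a `t`-group
  (∀ 𝔔 ∈ q.primesAbove, IsPGroup t ((𝔔.inertia (absoluteGaloisGroup F)).map ρ.toMonoidHom)) ∧
  -- (D5) `q` splits completely in every quadratic `K/F` unramified above residue characteristics `> b`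
  (∀ (K : Type) [Field K] [NumberField K] [Algebra F K], Module.finrank F K = 2 →
    (∀ Q : HeightOneSpectrum (𝓞 K), b < resChar Q → Q.asIdeal.ramificationIdx (𝓞 F) = 1) →
      ∀ Q : HeightOneSpectrum (𝓞 K), Q.asIdeal.under (𝓞 F) = q.asIdeal →
        Q.asIdeal.ramificationIdx (𝓞 F) = 1 ∧ Q.asIdeal.inertiaDeg (𝓞 F) = 1)

/-- **Good-dihedral Serre over the golden field at ramification depth `≤ r`** (KW's `(L_r)` with
the weight condition dropped — weak Serre allows any regular weight): every continuous irreducible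
totally odd `ρ̄ : Γ_F → GL₂(k)` (`F ≅ ℚ(√5)`, `char k = p`) carrying a good-dihedral datum and
ramified at no more than `r` places not dividing `p` is modular.  The dihedral place `q` is one of
those places, so `GDSerre 0` is vacuous and `GDSerre 1` is "ramified exactly at `q` away from `p`".
[cite: KhareWintenberger2009, §3.1 hypotheses (L_r), (W_r)] [folklore] -/
def GDSerre (r : ℕ) : Prop :=
  ∀ (F : Type) [Field F] [NumberField F], Module.finrank ℚ F = 2 → (∃ a : F, a ^ 2 = 5) →
    ∀ (p : ℕ) [Fact p.Prime], ∀ (k : Type) [Field k] [CharP k p] [IsAlgClosed k] [TopologicalSpace k]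
      [DiscreteTopology k], ∀ ρ : FramedGaloisRep F k 2, FramedRep.IsIrreducible ρ → ρ.IsOdd →
        ∀ (q : HeightOneSpectrum (𝓞 F)) (t b : ℕ), IsGoodDihedralDatum p ρ q t b →
          (∃ S : Finset (HeightOneSpectrum (𝓞 F)), S.card ≤ r ∧
              ∀ v ∉ S, ((p : ℕ) : 𝓞 F) ∉ v.asIdeal → ρ.IsUnramifiedAt v) →
            IsSerreModular p ρ

/-- **Good-dihedral Serre over the golden field** (all depths; KW's `(D_0)` without the parity
bookkeeping): every continuous irreducible totally odd `ρ̄ : Γ_F → GL₂(k)` carrying a good-dihedral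
datum is modular. [cite: KhareWintenberger2009, Thm. 3.4 hypothesis (D_r)] [folklore] -/
def GDSerreAll : Prop :=
  ∀ (F : Type) [Field F] [NumberField F], Module.finrank ℚ F = 2 → (∃ a : F, a ^ 2 = 5) →
    ∀ (p : ℕ) [Fact p.Prime], ∀ (k : Type) [Field k] [CharP k p] [IsAlgClosed k] [TopologicalSpace k]
      [DiscreteTopology k], ∀ ρ : FramedGaloisRep F k 2, FramedRep.IsIrreducible ρ → ρ.IsOdd →
        ∀ (q : HeightOneSpectrum (𝓞 F)) (t b : ℕ), IsGoodDihedralDatum p ρ q t b →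
          IsSerreModular p ρ

/-! ## 1. The open stubs -/

/-- **STUB A — raising levels (KW Thm. 3.4 over the golden field).**  Good-dihedral Serre over
`F ≅ ℚ(√5)` implies Serre for every irreducible totally odd `ρ̄` with NON-SOLVABLE image.  Paper
proof (KW §8.4 verbatim with split auxiliary primes): lift `ρ̄` to a weight-two strictly compatible
system (Taylor / Snowden potential modularity over totally real `F`, KW Thm. 5.1(2)); pass to a
large prime `p' ≡ 1 mod 4` above every residue characteristic in sight with `ρ̄_{p'}`
non-solvable (all but finitely many `p'` qualify once the system is potentially automorphic; KW
instead discharge a solvable `ρ̄_{p'}` by Lemma 6.2 — the statement of STUB B — and Skinner–Wiles /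
Kisin at `p'`); choose by Chebotarev (KW Lemma 8.2 over `F`) a split place `q` with
`N q ≡ -1 mod p'`, `ρ̄_{p'}^{proj}(Frob_q) ∼ ρ̄_{p'}^{proj}(c)`, `q` split in the finitely many
quadratic extensions of (D5), `ρ̄_{p'}` unramified at `q` and its conjugate; KW Thm. 5.1(4) gives a
lift with supercuspidal type `χ' ⊕ χ'^{Nq}` at `q`, `χ'` of niveau two and `p'`-power order; for the
largest prime `s < p'` the residual `ρ̄'_s` carries the good-dihedral datum `(q, t := p', b)` and is
modular by hypothesis; two modularity lifting theorems (Kisin, potentially Barsotti–Tate over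
totally real fields) climb back to `ρ̄`.  Why it might fail: the `F`-version of KW Thm. 5.1(4)
(existence of minimal lifts with prescribed supercuspidal type, via potential modularity and the
Khare–Wintenberger/Kisin `R = 𝕋` finiteness argument) at places above `2` and `√5`.
[cite: KhareWintenberger2009, Thm. 3.4, Thm. 5.1(4), Lemma 8.2, §8.4]
[cite: KhareWintenberger2009II, Thm. 4.1] [cite: KisinModuli2009, Thm. 0.1] -/
theorem stub_raiseToDihedral :
    GDSerreAll →
      ∀ (F : Type) [Field F] [NumberField F], Module.finrank ℚ F = 2 → (∃ a : F, a ^ 2 = 5) →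
        ∀ (p : ℕ) [Fact p.Prime], ∀ (k : Type) [Field k] [CharP k p] [IsAlgClosed k]
          [TopologicalSpace k] [DiscreteTopology k], ∀ ρ : FramedGaloisRep F k 2,
            FramedRep.IsIrreducible ρ → ρ.IsOdd → ¬ IsSolvable ρ.toMonoidHom.range →
              IsSerreModular p ρ := by
  sorry

/-- **STUB B — the solvable-image case (KW Lemma 6.2(i) over the golden field).**  Every
continuous irreducible totally odd `ρ̄ : Γ_F → GL₂(k)` (`F ≅ ℚ(√5)`) with SOLVABLE image is modular.
Paper proof: for `p ≥ 3` the image has order prime to `p` unless it contains `SL₂(𝔽₃)` (`p = 3`),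
and in all cases lifts to an odd Artin representation `ρ : Γ_F → GL₂(ℂ)` (Teichmüller lift;
`GL₂(𝔽₃) ⊂ GL₂(ℤ[√-2])`); tetrahedral/octahedral `ρ` are automorphic by Langlands–Tunnell (base
change for `GL₂` over the totally real `F`), dihedral ones by Hecke–Jacquet–Langlands automorphic
induction from the quadratic `K/F` (choosing the lift of the character with the signature that makes
`ρ` totally odd when `p = 2`, where KW Lemma 6.1 shows the image is projectively dihedral); total
oddness makes the weight-one form holomorphic, and multiplication by a lift of a power of the Hasse
invariant plus the Deligne–Serre lemma produces a congruent cuspidal eigenform of parallel weight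
`1 + m(p-1) ≥ 2`, i.e. a regular algebraic cuspidal `π` with the required Satake–Frobenius
congruences at almost all places.  Why it might fail: only in the typing — the Satake/`IsRegularAlgebraic`
API must be instantiable by Hilbert eigenforms of parallel weight (the same caveat as the Target).
[cite: KhareWintenberger2009, Lemma 6.1, Lemma 6.2(i)] [cite: Khare2006, §2] [folklore] -/
theorem stub_solvableImage :
    ∀ (F : Type) [Field F] [NumberField F], Module.finrank ℚ F = 2 → (∃ a : F, a ^ 2 = 5) →
      ∀ (p : ℕ) [Fact p.Prime], ∀ (k : Type) [Field k] [CharP k p] [IsAlgClosed k]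
        [TopologicalSpace k] [DiscreteTopology k], ∀ ρ : FramedGaloisRep F k 2,
          FramedRep.IsIrreducible ρ → ρ.IsOdd → IsSolvable ρ.toMonoidHom.range →
            IsSerreModular p ρ := by
  sorry

/-- **STUB C — the ladder (KW Thm. 3.1 "killing ramification in weight two" + Thm. 3.2 "weight
reduction" over the golden field).**  For `r ≥ 1`, good-dihedral Serre at depth `≤ r` implies it at
depth `≤ r + 1`.  Paper proof: given `ρ̄` (residue characteristic `p`) with datum `(q, t, b)` and
`r + 1` ramified places away from `p`, first run KW's weight cycles (§8.2: induction on the residue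
characteristic through the primes `2, 3, 5, ℓ ∣ P - 1`, all `≤ b`, with Khare's estimates of §7 and
the lifts of KW Thm. 5.1(2),(3)) to reach weight-two residual representations of the linked systems,
then kill one ramified place `v_s ≠ q` (§8.1): in the minimal weight-two compatible system the
`s`-adic member (`s = resChar v_s ≠ resChar q` by (D1)) has residual representation ramified at
`≤ r` places away from `s`, still carrying the datum `(q, t, b)` (KW Lemma 6.3: `t > b ≥ s`, and
(D5) forbids dihedral degeneration), hence modular by hypothesis; Kisin's potentially Barsotti–Tate
lifting theorem over totally real fields and Skinner–Wiles at forced-ordinary reducible detours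
climb back.  Why it might fail: the weight bookkeeping over `F` at the inert primes `3, 7`, at
`√5` (`e = 2`, Gee–Liu–Savitt/Schein recipe) and the `2`-adic potentially Barsotti–Tate lifting
theorem with `F_v = ℚ₄` (Kisin 2009 / Allen 2014 scope) — exactly the route's why-might-fail.
[cite: KhareWintenberger2009, Thm. 3.1, Thm. 3.2, Lemma 6.3, §7, §8.1, §8.2]
[cite: Khare2006, Thm. 1.1] [cite: KisinModuli2009, Thm. 0.1] [cite: SkinnerWiles1999, Thm. A] -/
theorem stub_dihedralLadder : ∀ r : ℕ, 1 ≤ r → GDSerre r → GDSerre (r + 1) := by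
  sorry

/-- **STUB D — the foot of the ladder (KW Thm. 3.3 = Khare 2006 Cor. 1.2 over the golden field).**
Level-one Serre over `F ≅ ℚ(√5)` implies good-dihedral Serre at depth `1`: a `ρ̄` with datum
`(q, t, b)` ramified only at `q` away from `p` is modular.  Paper proof: weight cycles as in STUB C
reduce to weight two; a minimal weight-two lift is Barsotti–Tate above `p`, so its compatible system
is ramified exactly at `q`; its `Nq`-adic member has LEVEL-ONE residual representation (unramified
away from `N q`, `q` being split with clean conjugate), modular by `LevelOneGolden`, with non-solvable
image by the niveau-two shape of the supercuspidal inertia at `q` (Khare 2006 §3); Kisin's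
potentially Barsotti–Tate lifting theorem at the split prime `N q` (`F_q = ℚ_{Nq}`) climbs back.
Why it might fail: as STUB C (weight reduction over `F`), plus adequacy of the level-one residual
image at `N q` when it is induced from `F(√±Nq)`-type fields.
[cite: KhareWintenberger2009, Thm. 3.3] [cite: Khare2006, Cor. 1.2, §3] [cite: KisinModuli2009, Thm. 0.1] -/
theorem stub_dihedralBase : LevelOneGolden → GDSerre 1 := by
  sorry

/-! ## 2. The stub statements as named propositions (the composition's hypotheses, by name) -/

namespace _Goal

/-- The statement of `stub_raiseToDihedral`, as a named `Prop` (literally its type). [folklore] -/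
def stub_raiseToDihedral : Prop :=
  type_of% @Summit.Langlands.Langlands.Cruxes.KillingRamificationGolden.Birth.stub_raiseToDihedral

/-- The statement of `stub_solvableImage`, as a named `Prop` (literally its type). [folklore] -/
def stub_solvableImage : Prop :=
  type_of% @Summit.Langlands.Langlands.Cruxes.KillingRamificationGolden.Birth.stub_solvableImage

/-- The statement of `stub_dihedralLadder`, as a named `Prop` (literally its type). [folklore] -/
def stub_dihedralLadder : Prop :=
  type_of% @Summit.Langlands.Langlands.Cruxes.KillingRamificationGolden.Birth.stub_dihedralLadder

/-- The statement of `stub_dihedralBase`, as a named `Prop` (literally its type). [folklore] -/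
def stub_dihedralBase : Prop :=
  type_of% @Summit.Langlands.Langlands.Cruxes.KillingRamificationGolden.Birth.stub_dihedralBase

end _Goal

/-! ## 3. The composition (kernel-checked, no `sorry`) -/

/-- Depth `0` is vacuous: a good-dihedral datum makes `ρ̄` ramified at `q ∤ p`. [folklore] -/
theorem gdSerre_zero : GDSerre 0 := by
  intro F _ _ _ _ p _ k _ _ _ _ _ ρ _ _ q t b hgd hS
  obtain ⟨S, hS0, hunr⟩ := hS
  have hSe : S = ∅ := Finset.card_eq_zero.mp (Nat.le_zero.mp hS0)
  exact absurd (hunr q (by simp [hSe]) hgd.1.1) hgd.1.2.2.1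

/-- Every depth, by induction: `0` vacuous, `1` = STUB D from level one, `r + 1 ⇐ r` = STUB C.
[folklore] -/
theorem gdSerre_of_stubs (hD : _Goal.stub_dihedralBase) (hC : _Goal.stub_dihedralLadder)
    (hL : LevelOneGolden) : ∀ r : ℕ, GDSerre r
  | 0 => gdSerre_zero
  | 1 => hD hL
  | r + 2 => hC (r + 1) (Nat.succ_le_succ (Nat.zero_le r)) (gdSerre_of_stubs hD hC hL (r + 1))

/-- All depths ⇒ all good-dihedral `ρ̄`: a continuous `ρ̄ : Γ_F → GL₂(k)` with `k` discrete has open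
kernel, hence is unramified at all but finitely many places (landed
`FramedGaloisRep.eventually_isUnramifiedAt_of_isOpen_ker`), so it sits at SOME finite depth.
[folklore] -/
theorem gdSerreAll_of_gdSerre (h : ∀ r : ℕ, GDSerre r) : GDSerreAll := by
  intro F _ _ hdeg h5 p _ k _ _ _ _ _ ρ hirr hodd q t b hgd
  have hker : IsOpen ((ρ.toMonoidHom.ker : Subgroup (absoluteGaloisGroup F)) :
      Set (absoluteGaloisGroup F)) := by
    have hset : ((ρ.toMonoidHom.ker : Subgroup (absoluteGaloisGroup F)) :
        Set (absoluteGaloisGroup F)) = ρ ⁻¹' {1} := by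
      ext g
      simp [MonoidHom.mem_ker]
    rw [hset]
    exact (isOpen_discrete _).preimage ρ.continuous
  have hfin := ρ.eventually_isUnramifiedAt_of_isOpen_ker hker
  rw [Filter.eventually_cofinite] at hfin
  refine h hfin.toFinset.card F hdeg h5 p k ρ hirr hodd q t b hgd ⟨hfin.toFinset, le_rfl, ?_⟩
  intro v hv _
  by_contra hv'
  exact hv (hfin.mem_toFinset.mpr hv')

/-- **`KillingRamificationGolden` from the four stubs.**  Assume level-one Serre over the golden
field.  STUB D puts good-dihedral Serre at depth `1`, STUB C climbs to every depth, finiteness of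
ramification gives it for every good-dihedral `ρ̄`, and then an arbitrary irreducible totally odd
`ρ̄` is modular by STUB A (non-solvable image, raising levels) or STUB B (solvable image).  The
conclusion is the route decl, by name. [cite: KhareWintenberger2009, §3.2] [folklore] -/
theorem KillingRamificationGolden_of (hA : _Goal.stub_raiseToDihedral) (hB : _Goal.stub_solvableImage)
    (hC : _Goal.stub_dihedralLadder) (hD : _Goal.stub_dihedralBase) :
    Summit.Langlands.Langlands.Theses.GoldenFieldSerre.KillingRamificationGolden := by
  intro hL F _ _ hdeg h5 p _ k _ _ _ _ _ ρ hirr hodd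
  have hGD : GDSerreAll := gdSerreAll_of_gdSerre (gdSerre_of_stubs hD hC hL)
  by_cases hsolv : IsSolvable ρ.toMonoidHom.range
  · exact hB F hdeg h5 p k ρ hirr hodd hsolv
  · exact hA hGD F hdeg h5 p k ρ hirr hodd hsolv

/-- By-name sanity check (an `example`, not a declaration of the file): the open stubs feed the
composition as they stand. -/
example : Summit.Langlands.Langlands.Theses.GoldenFieldSerre.KillingRamificationGolden :=
  KillingRamificationGolden_of stub_raiseToDihedral stub_solvableImage stub_dihedralLadder
    stub_dihedralBase

end Summit.Langlands.Langlands.Cruxes.KillingRamificationGolden.Birth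

end
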